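import Mathlib
import Summits.ValiantsHypothesis.ValiantsHypothesis.Theorems.FifoMatchingNNMonotoneHardBoundaries
import HarnessLib

/-!
# Crux `NNLinearDegreeCofactorHard` (stmt-ValiantsHypothesis-23918), line `internal_cofactor`: REPLICATION and the
# GATE-SPAN count on the abstract queue history (pieces §1, §3 of `Lines/internal_cofactor-S2b-D3architecture-p2.md`)

Measure-agnostic bookkeeping for the deterministic heart of BOTH the exponent-2 rung (stmt-24468, measure `inflateWord`)
and the ∀c re-method candidate μ* = `shedWord` (p1 g2), on the abstract queue history of
`…FifoMatchingNNMonotoneHardBoundaries.lean` (letters `W`, ranks `rO rC`, item times `o c`, respected colouring `σ`;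
item `k` = the `k`-th push, popped by the `k`-th pop; the FRONT at time `t` is item `rC t` when `rC t < rO t`):

* `colour_push`, `colour_pop` — a push at `t` creates an item of colour `σ t`; a pop at `t` removes the front, whose
  colour is `σ t` (respect);  `replication` — hence a push at a time that AGREES with the front (`σ t = colour of the
  front`; the other pushes are the TESTS, where a pop was forbidden) creates an item of the front's colour: away from tests,
  the queue's colour word reproduces itself (D3architecture §1);
* `pop_colour_eq_iff`, `rank_lt_iff_le_close` — during the passage of a block of items `[i₀, i₁)` of colour `c` followed by
  items `[i₁, i₂)` of colour `≠ c`, a pop time `s` has `σ s = c` iff `rC s < i₁` iff `s ≤ c (i₁ - 1)` (=: τ, the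
  EXHAUSTION time of the block);
* `disagreements_exhaustion_le_tests` — the number of positions of a set `P` (the fair positions of the window) at which
  `σ` disagrees with the step pattern «`c` up to `τ`, `≠ c` after `τ`» is at most the number of tests in `P`;
* `card_filter_Ioc_le_disagreements` — **gate span**: two candidate exhaustion times `u₁ ≤ u₂` whose step patterns each
  disagree with `σ` at `≤ d` positions of `P` have at most `2d` positions of `P` between them.  So «≤ d tests in the
  window» pins the random exhaustion time to a σ-determined set spanning `≤ 2d+1` fair positions — the GATE.

Honest framing: elementary deterministic bookkeeping; nothing here proves S11, (D*), S2b, the crux or VP ≠ VNP.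
No definitions, no named facts.
-/

-- Sub = Summit single-conjunct layout: the duplicated namespace component is mandated by the tree.
set_option linter.dupNamespace false

namespace Summit.ValiantsHypothesis.ValiantsHypothesis.Theorems.FifoMatching.NNLinearDegreeCofactorHard.QueueHistory

open Finset
open Summit.ValiantsHypothesis.ValiantsHypothesis.Theorems.FifoMatching.NNMonotoneHard

section AbstractQueue

variable {W σ : ℕ → Bool} {rO rC o c : ℕ → ℕ} {n' : ℕ}
variable (hOs : ∀ t, rO (t + 1) = rO t + (if W t = true then 1 else 0))
  (hCs : ∀ t, rC (t + 1) = rC t + (if W t = true then 0 else 1))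
  (ho : ∀ k t, k < n' → (o k < t ↔ k < rO t))
  (hc : ∀ k t, k < n' → (c k < t ↔ k < rC t))
  (hresp : ∀ k, k < n' → σ (o k) = σ (c k))

/-! ### Replication -/

include hOs ho in
/-- **A push at time `t` creates the item `rO t`, of colour `σ t`.** [folklore] -/
theorem colour_push {t : ℕ} (hW : W t = true) (hn : rO t < n') : σ (o (rO t)) = σ t := by
  rw [opener_at hOs ho hW hn]

include hCs hc hresp in
/-- **A pop at time `t` removes the front item `rC t`, whose colour is `σ t`** (respect). [folklore] -/
theorem colour_pop {t : ℕ} (hW : W t = false) (hn : rC t < n') : σ (o (rC t)) = σ t := by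
  rw [hresp _ hn, closer_at hCs hc hW hn]

include hOs ho in
/-- **Replication.**  A push at a time `t` that agrees with the front (`σ t = σ (o (rC t))` — i.e. NOT a test time)
creates an item of the front's colour. [folklore] -/
theorem replication {t : ℕ} (hW : W t = true) (hn : rO t < n') (hagree : σ t = σ (o (rC t))) :
    σ (o (rO t)) = σ (o (rC t)) := by
  rw [colour_push (σ := σ) hOs ho hW hn, hagree]

/-! ### The passage of a block boundary through the front -/

include hc in
/-- The front rank is below `i₁` iff the time is at most the pop time of item `i₁ - 1`. [folklore] -/
theorem rank_lt_iff_le_close {i₁ s : ℕ} (hi : 1 ≤ i₁) (hn : i₁ - 1 < n') :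
    rC s < i₁ ↔ s ≤ c (i₁ - 1) := by
  have h := hc (i₁ - 1) s hn
  constructor
  · intro hlt
    by_contra hgt
    push Not at hgt
    have := h.1 hgt
    omega
  · intro hle
    by_contra hge
    push Not at hge
    have : i₁ - 1 < rC s := by omega
    have := h.2 this
    omega

include hCs hc hresp in
/-- **Pop colours across a block boundary.**  Items `[i₀, i₁)` have colour `c`, items `[i₁, i₂)` do not; then a pop at a
time `s` whose front rank lies in `[i₀, i₂)` has `σ s = c` iff `rC s < i₁`. [folklore] -/
theorem pop_colour_eq_iff {i₀ i₁ i₂ : ℕ} {cl : Bool} (hi₂ : i₂ ≤ n')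
    (hblock : ∀ k, i₀ ≤ k → k < i₁ → σ (o k) = cl) (hblock' : ∀ k, i₁ ≤ k → k < i₂ → σ (o k) ≠ cl)
    {s : ℕ} (hW : W s = false) (h₀ : i₀ ≤ rC s) (h₂ : rC s < i₂) :
    σ s = cl ↔ rC s < i₁ := by
  have hcol := colour_pop hCs hc hresp hW (lt_of_lt_of_le h₂ hi₂)
  constructor
  · intro hs
    by_contra hge
    push Not at hge
    exact hblock' _ hge h₂ (hcol.trans hs)
  · intro hlt
    rw [← hcol]
    exact hblock _ h₀ hlt

include hCs hc hresp in
/-- **Disagreements with the step pattern are tests.**  With blocks as in `pop_colour_eq_iff`, let `P` be a set of times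
whose front ranks lie in `[i₀, i₂)` (the window of the two passages) and `τ := c (i₁ - 1)` the exhaustion time of the first
block.  Every `s ∈ P` at which `σ` disagrees with the step pattern (`c` on `s ≤ τ`, `≠ c` on `τ < s`) is a PUSH time that
disagrees with its front — a test. [folklore] -/
theorem disagreements_exhaustion_le_tests {i₀ i₁ i₂ : ℕ} {cl : Bool} (hi : 1 ≤ i₁) (hi₁ : i₁ ≤ i₂) (hi₂ : i₂ ≤ n')
    (hblock : ∀ k, i₀ ≤ k → k < i₁ → σ (o k) = cl) (hblock' : ∀ k, i₁ ≤ k → k < i₂ → σ (o k) ≠ cl)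
    (P : Finset ℕ) (hP : ∀ s ∈ P, i₀ ≤ rC s ∧ rC s < i₂) :
    (P.filter fun s => (s ≤ c (i₁ - 1) ∧ σ s ≠ cl) ∨ (c (i₁ - 1) < s ∧ σ s = cl)).card
      ≤ (P.filter fun s => W s = true ∧ σ s ≠ σ (o (rC s))).card := by
  refine card_le_card fun s hs => ?_
  rw [mem_filter] at hs ⊢
  obtain ⟨hsP, hdis⟩ := hs
  obtain ⟨h₀, h₂⟩ := hP s hsP
  refine ⟨hsP, ?_⟩
  have hrank := rank_lt_iff_le_close hc (s := s) hi (by omega)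
  cases hW : W s
  · -- a pop agrees with the step pattern: contradiction
    exfalso
    have key := pop_colour_eq_iff hCs hc hresp hi₂ hblock hblock' hW h₀ h₂
    rcases hdis with ⟨hle, hne⟩ | ⟨hlt, heq⟩
    · exact hne (key.2 (hrank.2 hle))
    · have := hrank.1 (key.1 heq); omega
  · refine ⟨rfl, ?_⟩
    rcases hdis with ⟨hle, hne⟩ | ⟨hlt, heq⟩
    · -- front rank `< i₁`: front colour `c`
      rw [hblock _ h₀ (hrank.2 hle)]; exact hne
    · -- front rank `≥ i₁`: front colour `≠ c`
      have hge : i₁ ≤ rC s := by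
        by_contra h; push Not at h; have := hrank.1 h; omega
      intro h
      exact hblock' _ hge h₂ (h ▸ heq.symm ▸ rfl)

end AbstractQueue

/-! ### The gate span (pure counting) -/

/-- **Gate span.**  For a set `P` of positions, a colouring `σ`, a colour `c` and two candidate exhaustion times
`u₁ ≤ u₂`: the positions of `P` in `(u₁, u₂]` are each a disagreement of the step pattern at `u₁` (colour `c` expected
only up to `u₁`) or of the step pattern at `u₂`.  Hence if both patterns disagree with `σ` at `≤ d` positions of `P`,
at most `2d` positions of `P` lie between `u₁` and `u₂`. [folklore] -/
theorem card_filter_Ioc_le_disagreements (P : Finset ℕ) (σ : ℕ → Bool) (cl : Bool) {u₁ u₂ : ℕ} (_hu : u₁ ≤ u₂) :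
    (P.filter fun s => u₁ < s ∧ s ≤ u₂).card
      ≤ (P.filter fun s => (s ≤ u₁ ∧ σ s ≠ cl) ∨ (u₁ < s ∧ σ s = cl)).card
        + (P.filter fun s => (s ≤ u₂ ∧ σ s ≠ cl) ∨ (u₂ < s ∧ σ s = cl)).card := by
  rw [← card_union_add_card_inter]
  refine le_trans ?_ (Nat.le_add_right _ _)
  refine card_le_card fun s hs => ?_
  rw [mem_filter] at hs
  obtain ⟨hsP, h1, h2⟩ := hs
  rw [mem_union, mem_filter, mem_filter]
  by_cases hσ : σ s = cl
  · exact Or.inl ⟨hsP, Or.inr ⟨h1, hσ⟩⟩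
  · exact Or.inr ⟨hsP, Or.inl ⟨h2, hσ⟩⟩

/-- **The gate, stated.**  If the actual exhaustion time `τ` and a candidate `u` both have step patterns within `d`
disagreements of `σ` on `P` (for `τ` this is «at most `d` tests in the window», by `disagreements_exhaustion_le_tests`), then
at most `2d` positions of `P` separate them. [folklore] -/
theorem card_filter_between_le_of_aligned (P : Finset ℕ) (σ : ℕ → Bool) (cl : Bool) (d : ℕ) {τ u : ℕ}
    (hτ : (P.filter fun s => (s ≤ τ ∧ σ s ≠ cl) ∨ (τ < s ∧ σ s = cl)).card ≤ d)
    (hu : (P.filter fun s => (s ≤ u ∧ σ s ≠ cl) ∨ (u < s ∧ σ s = cl)).card ≤ d) :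
    (P.filter fun s => min τ u < s ∧ s ≤ max τ u).card ≤ 2 * d := by
  rcases le_total τ u with h | h
  · rw [min_eq_left h, max_eq_right h]
    exact (card_filter_Ioc_le_disagreements P σ cl h).trans (by omega)
  · rw [min_eq_right h, max_eq_left h]
    exact (card_filter_Ioc_le_disagreements P σ cl h).trans (by omega)

end Summit.ValiantsHypothesis.ValiantsHypothesis.Theorems.FifoMatching.NNLinearDegreeCofactorHard.QueueHistory
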